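import Literature.NumberTheory.DiophantineGeometry.AbcValuationProduct
import HarnessLib
import HarnessLib.Audit
-- buildfix (bf1-g32) B32-8: comment-only touch to re-dispatch the lane build (prune victim: source 08-16, hub olean removed 22:46Z 08-28; deepest olean-less link under the ACTIVE route RibetTakahashiSplit (Theses edited 05:50Z); its closes-users/provers answer remote:stale:N:unbuilt); declarations byte-identical

/-!
# The milestone `AbcValuationProduct` (open; an obligation node of summit `ABC`)

`AbcValuationProduct` is Pasten's product-of-valuations bound for abc triples
(`Literature.NumberTheory.DiophantineGeometry.pasten2024_thm_2_5`: `∏_{p ∣ abc} ν_p(abc) ≤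
κ_ε · rad(abc)^{8/3 + ε}`, Theorem 2.5 of Invent. Math. 236 = Theorems 1.10–1.11 / 16.8 of the
Shimura-curve paper) with the exponent `8/3 + ε` LOWERED TO `ε`:

  `∀ ε > 0, ∃ K, ∀ abc triples, ∏_{p ∣ abc} ν_p(abc) ≤ K · rad(abc)^ε`

(equivalently `d(abc) ≪_ε rad(abc)^ε`). It is OPEN and is recorded here as an `@[conjecture]`
statement — never asserted; users take it as an explicit hypothesis `(h : AbcValuationProduct)`.
Its logical position is proved in the sibling files: it follows from the summit `ABC` (divisor
bound and `c ≪ rad²`: `abcValuationProduct_of_abc`), it implies Pasten's theorem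
(`pasten2024_thm_2_5_of_abcValuationProduct`) and sub-exponential abc `log c ≪_ε rad(abc)^ε` for
every `ε` (`subexp_of_abcValuationProduct`, the route glue `SubexpOfValuationProduct` of
ABC/RibetTakahashiSplit), and on the Frey–Hellegouarch class it is the valuation-product bound
`T(E) ≪_ε N_E^ε` (`RibetTakahashiSplitAbcValuationProductFreyClass.lean`) — the shape of the
folklore conjecture "fudge factors are small", `Tam(E) ≪_ε N_E^ε` (Conjecture 1.14 of the
Shimura-curve paper), at the multiplicative primes.

History: this statement was the route item `Summit.ABC.ABC.Theses.RibetTakahashiSplit.AbcValuationProduct`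
(stmt-ABC-1567) until the items-cap lint retired it from that route's item list on 2026-08-16;
the theorem files of `Summit.ABC.ABC.Theorems` name it unqualified, so it is re-homed here, in
their namespace, with the statement VERBATIM (the product spelled out rather than through
`exponentProduct`; the two agree by `rfl`, see `AbcValuationProduct_iff` in
`RibetTakahashiSplitAbcValuationProductReductions.lean`).

## References

* H. Pasten, *Shimura curves and the abc conjecture*, J. Number Theory 254 (2024), 214–335,
  arXiv:1705.09251 — Theorems 1.10, 1.11, 16.8; Conjecture 1.14. [PastenShimura2024]
* H. Pasten, *The largest prime factor of `n² + 1` and improvements on subexponential ABC*,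
  Invent. Math. 236 (2024), 373–385 — Theorem 2.5. [Pasten2024]
-/

-- `Summit.<Summit>.<Problem>` is the mandated summit-side namespace (CONVENTIONS §2); for the
-- single-conjunct summit `ABC` the two coincide, so the duplicate `ABC.ABC` is deliberate.
set_option linter.dupNamespace false

namespace Summit.ABC.ABC.Theorems

open Literature.NumberTheory.DiophantineGeometry

/-- OPEN — **the product-of-valuations bound with exponent `ε`.** For every `ε > 0` there is
`K` such that every abc triple `(a, b, c)` satisfies
`∏_{p ∣ abc} ν_p(abc) ≤ K · rad(abc)^ε` (`Real.rpow`; the left side is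
`exponentProduct (a * b * c)`, spelled out). Pasten's Theorems 1.10–1.11 give the exponent
`8/3 + ε` (`pasten2024_thm_2_5`); the exponent `ε` is open — a consequence of the abc conjecture,
and for Frey–Hellegouarch curves the valuation-product form of the folklore conjecture
`Tam(E) ≪_ε N_E^ε`. Never asserted; an explicit hypothesis wherever used. Verbatim the former
route item `Summit.ABC.ABC.Theses.RibetTakahashiSplit.AbcValuationProduct` (stmt-ABC-1567).
[cite: PastenShimura2024, Conjecture 1.14 (valuation-product form on abc triples: Theorems 1.10–1.11 with exponent ε; open)] -/
@[conjecture] def AbcValuationProduct : Prop :=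
  ∀ ε : ℝ, 0 < ε → ∃ K : ℝ, ∀ a b c : ℕ, IsABCTriple a b c →
    ((∏ p ∈ (a * b * c).primeFactors, (a * b * c).factorization p : ℕ) : ℝ) ≤
      K * ((rad a b c : ℕ) : ℝ) ^ ε

end Summit.ABC.ABC.Theorems
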